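import Summits.QuantumFields.GaugeBoot.DiagonalRPTorusSignExpansion
import HarnessLib

/-!
# Closed-half diagonal RP FAILS on the odd three-torus `(ℤ/3)³` (gauge-boot, task L3(λ), 3/3)

HONEST FRAMING (cell `pub-gaugeboot`, page 1 of every file): the venture produces certified bounds
on lattice expectations at stated coupling, gauge group, dimension and torus size; NOT a mass gap,
NOT a continuum limit, NOT a string tension; NOT Yang–Mills-summit-bearing (barriers
`FixedCouplingUltralocality`, `PerturbativeInvisibility`). This module is a small NEGATIVE result
about a positivity constraint on ONE finite torus (`d = 3`, `L = 3`) for gauge groups carrying a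
sign character; it discharges nothing else.

## Content

`DiagonalRPTorusOdd` (`DiagRPTwo.diagonalReflectionPositive_two_odd`, task L3(θ)) proves the
torus transplant `DiagonalReflectionPositive ρ β i j` of closed-half-space diagonal reflection
positivity for EVERY compact group, every continuous representation, every `β ≥ 0` and every ODD
`L ≥ 3` — in dimension `d = 2`. `DiagonalRPTorusNegative` (L3(γ)) kills it on EVEN tori in
`d ≥ 3`. This file shows that the odd-torus statement has NO three-dimensional analogue either:

* **`DiagRPThree.not_diagonalReflectionPositive_three`** — for `d = 3`, `L = 3`, the swap of the
  coordinates `0, 1`, every compact group `G`, every continuous one-dimensional representation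
  `ρ : G →* Matrix (Fin 1) (Fin 1) ℂ` with values in `{1, -1}` attaining `-1` (a sign character:
  `ℤ₂`, `O(n)` through `det`, `S_n` through `sgn`, …) and every `0 < β ≤ 1/2000`,
  `¬ DiagonalReflectionPositive (d := 3) (L := 3) ρ β 0 1`.
* **`DiagRPThree.not_diagonalReflectionPositive_three_intUnits`** — the concrete instance
  `G = ℤˣ = {1, -1}` with its sign representation `signRepIntUnits` (`ℤ₂` lattice gauge theory;
  discrete topology, all instances from Mathlib): the hypotheses above are met, so the negative
  is not vacuous.

## Mechanism: Polyakov loops and the wrap-around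

Write `σ = Re tr ρ ∈ {±1}` and `P_{(a,b)}(U) = σ(U((a,b,0),2)) σ(U((a,b,1),2)) σ(U((a,b,2),2))` for
the Polyakov loop winding in the spectator direction `2` over the column `(a, b) ∈ (ℤ/3)²`. The
closed half of the mirror `x₀ = x₁` consists of the levels `x₀ - x₁ ∈ {0, 1}`; the columns `(1,0)`
and `(2,1)` lie at level `1`, so `F = P_{(1,0)} - P_{(2,1)}` is a bounded measurable closed-half
observable, and `ΘF = P_{(0,1)} - P_{(1,2)}`. On the `3 × 3` torus the reflected column `(0,1)` is
a NEAREST neighbour of `(2,1)` (`0 ≡ 2 + 1`) but at graph distance `2` from its own preimage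
`(1,0)`. By the `ℤ₂` character expansion and the product-Haar link integrals
(`DiagonalRPTorusSignExpansion.wilsonExpectation_polDiff`),
`⟨(ΘF)‾ F⟩_{Λ,β} = Z⁻¹ (e^{-β} cosh β)^81 · (K(01,10) - K(01,21) - K(12,10) + K(12,21))` with
`K(A,B) = Σ_{S ⊆ plaquettes} t^{|S|} [∂S = column A + column B]`, `t = tanh β`. Two finite facts
decide the sign for small `t`:
(i) the three-plaquette ladders between the columns `(0,1)`, `(2,1)` and `(1,2)`, `(1,0)` have
exactly those boundaries (`even_lad1`, `even_lad2`), so `K(01,21), K(12,10) ≥ t³`;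
(ii) the six links of the non-adjacent column pair `(0,1)`, `(1,0)` (resp. `(1,2)`, `(2,1)`) are six
disjoint one-link cuts (`cuts_mk1`, `cuts_mk2`: no plaquette contains two of them), so a plaquette
set with that boundary has at least six plaquettes (`card_le_of_cuts`) and
`K(01,10), K(12,21) ≤ Σ_{|S| ≥ 6} t^{|S|} ≤ (t/u)⁶(1+u)^81 ≤ t³/2` (`u = 2/25`, `t ≤ 1/1999`).
Hence `⟨(ΘF)‾ F⟩_{Λ,β} < 0`. The finite facts are `decide`d over the 81 links / 81 plaquettes of
`(ℤ/3)³`; nothing is enumerated over surfaces. (Desk check, exact over all `2^29` closed surfaces,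
cell files `HOME/pub-gaugeboot-lean3/gen30/z2poly/`: `Z·⟨(ΘF)F⟩ ∝ -2t³ + 2t⁶ - 12t⁷ + 12t⁸ - …`,
negative for every `t = k/1000`, `k = 1, …, 999`; the small-`β` window is what this file PROVES.)

## What is NOT claimed

Nothing about `β > 1/2000` (numerically the same witness is negative at every `β > 0`), nothing
about other odd `L` (the same columns give `t^L` against `t^{(L-1)L}`, not formalised), nothing
about the even-`L` INNER half, nothing about groups without a sign character (e.g. `SU(N)`), and
nothing about infinite volume: diagonal RP on `ℤ³` / free boxes holds (`DiagonalRPFiniteVolume`).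

Sources: Osterwalder–Seiler, Ann. Phys. 110 (1978) 440, §2 (the RP mechanism whose torus
transplant is tested); Kazakov–Zheng, arXiv:2203.11360 §3.1 (the diagonal reflection family). The
negative itself is elementary and, as far as the cell's searches go (HOME/FRESHNESS.md), not in
print as a theorem. Printed precedent (nearest-neighbour spin systems, a remark without proof): periodic boundary conditions destroy
diagonal RP — Fröhlich–Israel–Lieb–Simon, J. Stat. Phys. 22 (1980) 297, §3 (Model 3.1); M. Biskup, in LNM 1970
(2009) §5.5; the statements here are theorem-level, gauge-theoretic forms of that obstruction (tribunal t2 F-R1).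
-/

open MeasureTheory Complex Finset
open scoped ComplexOrder

namespace Summit.QuantumFields.GaugeBoot

open Literature.MathematicalPhysics.QuantumFieldTheory

namespace DiagRPThree

/-! ## The finite data of `(ℤ/3)³` (computable; the facts are `decide`d) -/

section Data

/-- The site `(a, b, c)` of `(ℤ/3)³`. -/
def st (a b c : ZMod 3) : Site 3 3 := ![a, b, c]

/-- The coordinate plane `(0, 2)`. -/
def pl02 : {q : Fin 3 × Fin 3 // q.1 < q.2} := ⟨(0, 2), by decide⟩

/-- The coordinate plane `(1, 2)`. -/
def pl12 : {q : Fin 3 × Fin 3 // q.1 < q.2} := ⟨(1, 2), by decide⟩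

/-- The three-plaquette ladder joining the columns `(2,1)` and `(0,1) = (2+1, 1)`: the
`(0,2)`-plaquettes based at `(2,1,z)`, `z ∈ ℤ/3`. -/
def lad1 : Finset (Plaquette 3 3) := {(st 2 1 0, pl02), (st 2 1 1, pl02), (st 2 1 2, pl02)}

/-- The three-plaquette ladder joining the columns `(1,2)` and `(1,0) = (1, 2+1)`: the
`(1,2)`-plaquettes based at `(1,2,z)`, `z ∈ ℤ/3`. -/
def lad2 : Finset (Plaquette 3 3) := {(st 1 2 0, pl12), (st 1 2 1, pl12), (st 1 2 2, pl12)}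

/-- The six links of the columns `(0,1)` and `(1,0)` (six one-link cuts). -/
def mk1 : Finset (Edge 3 3) :=
  {(st 0 1 0, 2), (st 0 1 1, 2), (st 0 1 2, 2), (st 1 0 0, 2), (st 1 0 1, 2), (st 1 0 2, 2)}

/-- The six links of the columns `(1,2)` and `(2,1)` (six one-link cuts). -/
def mk2 : Finset (Edge 3 3) :=
  {(st 1 2 0, 2), (st 1 2 1, 2), (st 1 2 2, 2), (st 2 1 0, 2), (st 2 1 1, 2), (st 2 1 2, 2)}

/-- `lad1` has three plaquettes. -/
theorem card_lad1 : lad1.card = 3 := by decide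

/-- `lad2` has three plaquettes. -/
theorem card_lad2 : lad2.card = 3 := by decide

/-- `mk1` has six links. -/
theorem card_mk1 : mk1.card = 6 := by decide

/-- `mk2` has six links. -/
theorem card_mk2 : mk2.card = 6 := by decide

/-- The torus `(ℤ/3)³` has `81` plaquettes. -/
theorem card_plaquette_three : Fintype.card (Plaquette 3 3) = 81 := by decide

/-- The mod-2 boundary of the ladder `lad1` is `column (0,1) + column (2,1)`. -/
theorem even_lad1 : ∀ e : Edge 3 3, Even (degS lad1 e + ccnt (0, 1) e + ccnt (2, 1) e) := by
  decide

/-- The mod-2 boundary of the ladder `lad2` is `column (1,2) + column (1,0)`. -/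
theorem even_lad2 : ∀ e : Edge 3 3, Even (degS lad2 e + ccnt (1, 2) e + ccnt (1, 0) e) := by
  decide

/-- Each link of `mk1` separates the columns `(0,1)`, `(1,0)` (it lies in exactly one of them). -/
theorem odd_mk1 :
    ∀ k ∈ mk1, Odd (∑ e ∈ ({k} : Finset (Edge 3 3)), (ccnt (0, 1) e + ccnt (1, 0) e)) := by
  decide

/-- Each link of `mk2` separates the columns `(1,2)`, `(2,1)`. -/
theorem odd_mk2 :
    ∀ k ∈ mk2, Odd (∑ e ∈ ({k} : Finset (Edge 3 3)), (ccnt (1, 2) e + ccnt (2, 1) e)) := by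
  decide

/-- No plaquette contains two links of `mk1` (the columns `(0,1)` and `(1,0)` are NOT adjacent):
the six one-link cuts are disjoint. -/
theorem cuts_mk1 : ∀ p : Plaquette 3 3,
    (mk1.filter fun k => Odd (∑ e ∈ ({k} : Finset (Edge 3 3)), pcnt p e)).card ≤ 1 := by
  decide

/-- No plaquette contains two links of `mk2` (the columns `(1,2)` and `(2,1)` are NOT adjacent). -/
theorem cuts_mk2 : ∀ p : Plaquette 3 3,
    (mk2.filter fun k => Odd (∑ e ∈ ({k} : Finset (Edge 3 3)), pcnt p e)).card ≤ 1 := by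
  decide

/-- A plaquette set with boundary `column (0,1) + column (1,0)` has at least six plaquettes. -/
theorem six_le_card_01_10 {S : Finset (Plaquette 3 3)}
    (hS : ∀ e, Even (degS S e + ccnt (0, 1) e + ccnt (1, 0) e)) : 6 ≤ S.card := by
  have h := card_le_of_cuts mk1 (fun k => {k}) odd_mk1 cuts_mk1 hS
  rwa [card_mk1] at h

/-- A plaquette set with boundary `column (1,2) + column (2,1)` has at least six plaquettes. -/
theorem six_le_card_12_21 {S : Finset (Plaquette 3 3)}
    (hS : ∀ e, Even (degS S e + ccnt (1, 2) e + ccnt (2, 1) e)) : 6 ≤ S.card := by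
  have h := card_le_of_cuts mk2 (fun k => {k}) odd_mk2 cuts_mk2 hS
  rwa [card_mk2] at h

end Data

/-! ## The four `K`-sums at `L = 3` and the sign of their combination -/

section Numerics

/-- `K_t((0,1),(2,1)) ≥ t³` (the ladder `lad1`). -/
theorem ksum_01_21 {t : ℝ} (ht : 0 ≤ t) : t ^ 3 ≤ ksum (L := 3) t (0, 1) (2, 1) := by
  have h := pow_card_le_ksum (t := t) ht even_lad1
  rwa [card_lad1] at h

/-- `K_t((1,2),(1,0)) ≥ t³` (the ladder `lad2`). -/
theorem ksum_12_10 {t : ℝ} (ht : 0 ≤ t) : t ^ 3 ≤ ksum (L := 3) t (1, 2) (1, 0) := by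
  have h := pow_card_le_ksum (t := t) ht even_lad2
  rwa [card_lad2] at h

/-- `K_t((0,1),(1,0)) ≤ (t/u)⁶(1+u)^81`. -/
theorem ksum_01_10 {t u : ℝ} (ht : 0 ≤ t) (htu : t ≤ u) (hu : 0 < u) :
    ksum (L := 3) t (0, 1) (1, 0) ≤ (t / u) ^ 6 * (1 + u) ^ 81 := by
  have h := ksum_le_of_le_card ht htu hu fun _ hS => six_le_card_01_10 hS
  rwa [card_plaquette_three] at h

/-- `K_t((1,2),(2,1)) ≤ (t/u)⁶(1+u)^81`. -/
theorem ksum_12_21 {t u : ℝ} (ht : 0 ≤ t) (htu : t ≤ u) (hu : 0 < u) :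
    ksum (L := 3) t (1, 2) (2, 1) ≤ (t / u) ^ 6 * (1 + u) ^ 81 := by
  have h := ksum_le_of_le_card ht htu hu fun _ hS => six_le_card_12_21 hS
  rwa [card_plaquette_three] at h

/-- The numerical tail estimate: `(t/u)⁶(1+u)^81 ≤ t³/2` for `u = 2/25`, `0 < t ≤ 1/1999`
(`(27/25)^81 ≤ 510`, `(25/2)⁶ · 510 / 1999³ ≈ 0.24`). -/
theorem tail_le {t : ℝ} (ht0 : 0 < t) (ht : t ≤ 1 / 1999) :
    (t / (2 / 25)) ^ 6 * (1 + 2 / 25) ^ 81 ≤ t ^ 3 / 2 := by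
  have h1 : (1 + 2 / 25 : ℝ) ^ 81 ≤ 510 := by norm_num
  have h3 : t ^ 3 ≤ (1 / 1999) ^ 3 := pow_le_pow_left₀ ht0.le ht 3
  have ht3 : 0 < t ^ 3 := pow_pos ht0 3
  have hc : ((1 : ℝ) / 1999) ^ 3 * ((25 / 2) ^ 6 * 510) ≤ 1 / 2 := by norm_num
  calc (t / (2 / 25)) ^ 6 * (1 + 2 / 25) ^ 81
      = t ^ 3 * (t ^ 3 * (25 / 2) ^ 6) * (1 + 2 / 25) ^ 81 := by ring
    _ ≤ t ^ 3 * (t ^ 3 * (25 / 2) ^ 6) * 510 := by gcongr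
    _ = t ^ 3 * (t ^ 3 * ((25 / 2) ^ 6 * 510)) := by ring
    _ ≤ t ^ 3 * ((1 / 1999) ^ 3 * ((25 / 2) ^ 6 * 510)) := by gcongr
    _ ≤ t ^ 3 * (1 / 2) := by gcongr
    _ = t ^ 3 / 2 := by ring

/-- **The sign of the RP form on the Polyakov witness**: for `0 < β ≤ 1/2000`,
`K(01,10) - K(01,21) - K(12,10) + K(12,21) < 0` at `t = tanh β`. -/
theorem ksum_combination_neg {β : ℝ} (hβ : 0 < β) (hβ1 : β ≤ 1 / 2000) :
    ksum (L := 3) (Real.tanh β) (0, 1) (1, 0) - ksum (L := 3) (Real.tanh β) (0, 1) (2, 1) -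
        ksum (L := 3) (Real.tanh β) (1, 2) (1, 0) + ksum (L := 3) (Real.tanh β) (1, 2) (2, 1) <
      0 := by
  set t := Real.tanh β with ht_def
  have ht0 : 0 < t := by
    rw [ht_def, Real.tanh_eq_sinh_div_cosh]
    exact div_pos (Real.sinh_pos_iff.2 hβ) (Real.cosh_pos β)
  have ht1 : t ≤ 1 / 1999 := by
    have h := tanh_le_add_sq hβ.le (by linarith)
    nlinarith
  have htu : t ≤ 2 / 25 := by linarith
  have hu : (0 : ℝ) < 2 / 25 := by norm_num
  have h1 := ksum_01_10 ht0.le htu hu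
  have h2 := ksum_01_21 ht0.le
  have h3 := ksum_12_10 ht0.le
  have h4 := ksum_12_21 ht0.le htu hu
  have h5 := tail_le ht0 ht1
  nlinarith [pow_pos ht0 3]

end Numerics

/-! ## The theorem -/

section Main

variable {G : Type*} [Group G] [TopologicalSpace G] [IsTopologicalGroup G] [CompactSpace G]
  [MeasurableSpace G] [BorelSpace G] {ρ : G →* Matrix (Fin 1) (Fin 1) ℂ}

omit [TopologicalSpace G] [IsTopologicalGroup G] [CompactSpace G] [MeasurableSpace G]
  [BorelSpace G] in
/-- The witness `P_{(1,0)} - P_{(2,1)}` is an observable of the CLOSED diagonal half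
`{x₀ - x₁ ∈ {0, 1}}` of the mirror `x₀ = x₁`: its links are the direction-`2` links over the
level-`1` columns `(1,0)` and `(2,1)`. -/
theorem isDiagonalHalfObservable_polDiff :
    IsDiagonalHalfObservable (0 : Fin 3) 1 (polDiff ρ ((1, 0) : ZMod 3 × ZMod 3) (2, 1) :
      GaugeConfig 3 3 G → ℂ) := by
  intro U V hUV
  have key : ∀ A : ZMod 3 × ZMod 3, A.1 - A.2 = 1 → ∀ e : Edge 3 3, ccnt A e ≠ 0 → U e = V e := by
    intro A hA e he
    obtain ⟨h2, h0, h1⟩ := ccnt_ne_zero he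
    refine hUV e ?_ ?_
    · rw [h0, h1, hA]
      decide
    · rw [h2, WilsonRP.shift_apply_of_ne e.1 (show (0 : Fin 3) ≠ 2 by decide),
        WilsonRP.shift_apply_of_ne e.1 (show (1 : Fin 3) ≠ 2 by decide), h0, h1, hA]
      decide
  exact polDiff_congr _ _ fun e he =>
    he.elim (key (1, 0) (by decide) e) (key (2, 1) (by decide) e)

/-- **L3(λ): closed-half diagonal reflection positivity FAILS on the odd three-torus `(ℤ/3)³`.**
For every compact group `G`, every continuous one-dimensional representation `ρ` with values in
`{1, -1}` attaining `-1` (a sign character) and every coupling `0 < β ≤ 1/2000`, the torus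
transplant `DiagonalReflectionPositive (d := 3) (L := 3) ρ β 0 1` of closed-half-space diagonal
RP (the statement L3(θ) `DiagRPTwo.diagonalReflectionPositive_two_odd` proves for ALL odd `L ≥ 3`,
all compact `G`, all continuous `ρ`, all `β ≥ 0` in `d = 2`) is FALSE. Witness: the difference
`F = P_{(1,0)} - P_{(2,1)}` of two Polyakov loops in the spectator direction; `⟨(ΘF)‾ F⟩_{Λ,β} < 0`
because the reflected column `(0,1)` is adjacent to `(2,1)` across the torus but at distance `2`
from `(1,0)` (three-plaquette ladders `t³` against six-plaquette surfaces `O(t⁶)`, `t = tanh β`). -/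
theorem not_diagonalReflectionPositive_three (hρ : Continuous ρ) (hval : ∀ g, ρ g = 1 ∨ ρ g = -1)
    (hne : ∃ g, ρ g = -1) {β : ℝ} (hβ : 0 < β) (hβ1 : β ≤ 1 / 2000) :
    ¬ DiagonalReflectionPositive (d := 3) (L := 3) ρ β 0 1 := fun hRP =>
  not_nonneg_wilsonExpectation_polDiff hρ hval hne β ((1, 0) : ZMod 3 × ZMod 3) (2, 1)
    (by simpa only [Prod.swap_prod_mk] using ksum_combination_neg hβ hβ1)
    (hRP _ (measurable_polDiff hρ _ _) ⟨2, norm_polDiff_le hval _ _⟩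
      isDiagonalHalfObservable_polDiff)

/-- **`ℤ₂` lattice gauge theory on `(ℤ/3)³` violates closed-half diagonal RP** for every
`0 < β ≤ 1/2000`: the theorem `not_diagonalReflectionPositive_three` is not vacuous — the
two-element group `ℤˣ` (discrete topology, normalised counting measure as Haar probability) with
its sign representation `signRepIntUnits` satisfies all its hypotheses. -/
theorem not_diagonalReflectionPositive_three_intUnits {β : ℝ} (hβ : 0 < β) (hβ1 : β ≤ 1 / 2000) :
    ¬ DiagonalReflectionPositive (d := 3) (L := 3) signRepIntUnits β 0 1 :=
  not_diagonalReflectionPositive_three continuous_of_discreteTopology signRepIntUnits_eq_one_or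
    ⟨-1, signRepIntUnits_neg_one⟩ hβ hβ1

end Main

end DiagRPThree

end Summit.QuantumFields.GaugeBoot
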